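import Summits.Parity.GeneralizedHardyLittlewood.Theses.GreenTaoLevelTwo
import Summits.Parity.GeneralizedHardyLittlewood.Theorems.GreenTaoLevelTwoGITwoCyclicInverseLocalQuadraticUniform
import Summits.Parity.GeneralizedHardyLittlewood.Theorems.GreenTaoLevelTwoGITwoCyclicInverseDatum
import HarnessLib

/-!
# Route `GreenTaoLevelTwo`, crux `GITwo` (stmt-Parity-21275), line `birth`: the stub
# `stub_cyclicInverse` — the inverse theorem for `U³(ℤ/Nℤ)` over the Heisenberg class
# (Green–Tao 2008a, arXiv:math/0503014 Thm. 68 = PEMS 51 (2008) Thm. 12.8), BY NAME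

The XL registered stub of the `GITwo` birth skeleton, with its signature spelled out: for every
compatible box-comparable metric `d` on `H³(ℝ)/H³(ℤ)` and every `0 < η ≤ 1` there are finitely many
nilmanifolds `𝓜ᵢ` in the Heisenberg class of `H_d` and constants `M, c > 0` such that for every prime
`N' > 2` and every `f : ℤ/N'ℤ → [−1,1]` with `‖f‖⁸_{U³} ≥ η⁸` some real `1`-bounded `M`-Lipschitz `F` on
some `𝓜ᵢ` and some orbit correlate `≥ c` with a translate of `f` over the representatives
`−N'/2 < n < N'/2`.

The proof is the assembly of the ninety-odd helper files `…GITwoCyclicInverse*` (arXiv §§5–12):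
1. `local_quadratic_correlation_uniform` (§§5–9, Thm. 17 (i) for `ℤ/N`, constants uniform in `N`):
   `f` correlates on a regular Bohr set `B(S',ρ₅)` with a locally quadratic phase
   `e(cμ(x₀+w)(x₀+w)/N)e(wζ/N)`, `μ` additive on `B(S',ρ₄)`, `#S' ≤ D(η)`, `κ ≥ K(η)`, `ρ₅ ≥ R(η)`;
2. `exists_tiny_regular_bohr` (§12 with Lemma 21): localisation to a translate of a tiny regular Bohr
   set `B(S',ρ₆)`, `ρ₆ ≍ κρ₅/(d³2^{d(d+2)})`;
3. `exists_factorised_bracket_correlation` (§10 Prop. 54 + §12): the phase is a product of a character,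
   `d` linear and `d²` quadratic bracket monomials carrying the smoothing cutoffs;
4. `exists_real_correlation_of_bracket` (§12 Lemmas 65, 69): realisation on the product nilmanifold
   `Z_d` chosen in advance by `exists_uniform_tensor` (the family is `(Z_d)_{d ≤ D(η)}`), passage to a
   real `F`; the Lipschitz constant and the correlation are bounded by explicit functions of `η`, `L`.

References: B. Green, T. Tao, *An inverse theorem for the Gowers `U³(G)` norm*, Proc. Edinb. Math.
Soc. 51 (2008) 73–153 = arXiv:math/0503014, Thm. 12.8 / Thm. 68 and §§5–12 [GreenTao2008U3Inverse];
B. Green, T. Tao, *Linear equations in primes*, Ann. of Math. 171 (2010), Prop. 8.4 [GreenTao2010].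
-/

noncomputable section

open Finset ZMod
open Literature.NumberTheory.Sieve
open Literature.NumberTheory.Sieve.GreenTaoLevelTwo (HX IsCompatMetric IsBoxComparable heisenbergWith
  InHeisClass heisPreDist)

namespace Summit.Parity.GeneralizedHardyLittlewood.GreenTaoLevelTwoGITwoCyclicInverse

/-- Monotonicity of the `1`-bounded Lipschitz predicate in the constant. [folklore] -/
theorem isBoundedLipschitz_mono {Z : Nilmanifold 2} {M M' : ℝ} {F : Z.G ⧸ Z.Γ → ℝ}
    (hF : Z.IsBoundedLipschitz M F) (hMM' : M ≤ M') : Z.IsBoundedLipschitz M' F :=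
  ⟨hF.1, fun y z => (hF.2 y z).trans (mul_le_mul_of_nonneg_right hMM' (Z.dist_nonneg y z))⟩

/-- **`stub_cyclicInverse` (registered XL stub of the `GITwo` skeleton, BY NAME, signature spelled
out): the inverse theorem for the `U³(ℤ/N'ℤ)` norm, elementary `2`-step nilsequence version over the
Heisenberg class of `H_d` (Green–Tao 2008a Thm. 12.8 / arXiv Thm. 68, real form, with the Remark after
it: skew-shift factors are dispensable).**  For every compatible box-comparable metric `d` and
`0 < η ≤ 1` there are a finite family `𝓜ᵢ` (`i ≤ D(η)`, products of circles and copies of `H_d`) and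
`M, c > 0` such that every `1`-bounded `f : ℤ/N'ℤ → ℝ` (`N' > 2` prime) with `η⁸ ≤ ‖f‖⁸_{U³}` has
`c ≤ |(∑_{−N'/2<n<N'/2} f(n+h) F(gⁿx₀))/N'|` for some `1`-bounded `M`-Lipschitz real `F` on some `𝓜ᵢ`.
[cite: GreenTao2008U3Inverse, Thm. 12.8 (= arXiv Thm. 68) and §§5–12] -/
theorem stub_cyclicInverse :
    ∀ (d : HX → HX → ℝ) (h : IsCompatMetric d), IsBoxComparable d →
      ∀ η : ℝ, 0 < η → η ≤ 1 → ∃ (m : ℕ) (𝓜 : Fin m → Nilmanifold 2) (M c : ℝ),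
        (∀ i, InHeisClass (heisenbergWith d h) (𝓜 i)) ∧ 0 < c ∧
          ∀ (N' : ℕ) [NeZero N'], N'.Prime → 2 < N' → ∀ f : ZMod N' → ℝ, (∀ x, |f x| ≤ 1) →
            η ^ 8 ≤ gowersPower 3 f →
              ∃ (i : Fin m) (g : (𝓜 i).G) (x₀ : (𝓜 i).G ⧸ (𝓜 i).Γ) (hsh : ZMod N')
                (F : (𝓜 i).G ⧸ (𝓜 i).Γ → ℝ),
                (𝓜 i).IsBoundedLipschitz M F ∧
                  c ≤ |(∑ n ∈ Finset.Icc (-((N' : ℤ) / 2)) ((N' : ℤ) / 2),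
                      f ((n : ZMod N') + hsh) * F (g ^ n • x₀)) / N'| := by
  classical
  intro dH h hbox η hη hη1
  obtain ⟨L, hL0, hcomp⟩ := hbox
  -- Step 0: the constants of §9, uniform in `N`, for `ε = η⁸`
  have hε0 : 0 < η ^ 8 := by positivity
  have hε1 : η ^ 8 ≤ 1 := pow_le_one₀ hη.le hη1
  obtain ⟨D, K, R, hK0, hK1, hR0, hdata⟩ := local_quadratic_correlation_uniform hε0 hε1
  -- the family: the uniform tensor nilmanifold of the factor family, one for each `d' : ℕ`
  have hZ : ∀ d' : ℕ, ∃ Z : Nilmanifold 2, InHeisClass (heisenbergWith dH h) Z ∧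
      ∀ (Φ : ∀ i : Unit ⊕ (Fin d' ⊕ (Fin d' × Fin d')),
          (Sum.elim (fun _ => Nilmanifold.circle.ofLE (by norm_num : 1 ≤ 2))
            (Sum.elim
              (fun _ => (Nilmanifold.circle.ofLE (by norm_num : 1 ≤ 2)).prod
                (Nilmanifold.circle.ofLE (by norm_num : 1 ≤ 2)))
              (fun _ => ((Nilmanifold.circle.ofLE (by norm_num : 1 ≤ 2)).prod
                (Nilmanifold.circle.ofLE (by norm_num : 1 ≤ 2))).prod
                  ((heisenbergWith dH h).prod (heisenbergWith dH h)))) i).G ⧸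
          (Sum.elim (fun _ => Nilmanifold.circle.ofLE (by norm_num : 1 ≤ 2))
            (Sum.elim
              (fun _ => (Nilmanifold.circle.ofLE (by norm_num : 1 ≤ 2)).prod
                (Nilmanifold.circle.ofLE (by norm_num : 1 ≤ 2)))
              (fun _ => ((Nilmanifold.circle.ofLE (by norm_num : 1 ≤ 2)).prod
                (Nilmanifold.circle.ofLE (by norm_num : 1 ≤ 2))).prod
                  ((heisenbergWith dH h).prod (heisenbergWith dH h)))) i).Γ → ℂ)
        (g : ∀ i, (Sum.elim (fun _ => Nilmanifold.circle.ofLE (by norm_num : 1 ≤ 2))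
            (Sum.elim
              (fun _ => (Nilmanifold.circle.ofLE (by norm_num : 1 ≤ 2)).prod
                (Nilmanifold.circle.ofLE (by norm_num : 1 ≤ 2)))
              (fun _ => ((Nilmanifold.circle.ofLE (by norm_num : 1 ≤ 2)).prod
                (Nilmanifold.circle.ofLE (by norm_num : 1 ≤ 2))).prod
                  ((heisenbergWith dH h).prod (heisenbergWith dH h)))) i).G)
        (p : ∀ i, (Sum.elim (fun _ => Nilmanifold.circle.ofLE (by norm_num : 1 ≤ 2))
            (Sum.elim
              (fun _ => (Nilmanifold.circle.ofLE (by norm_num : 1 ≤ 2)).prod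
                (Nilmanifold.circle.ofLE (by norm_num : 1 ≤ 2)))
              (fun _ => ((Nilmanifold.circle.ofLE (by norm_num : 1 ≤ 2)).prod
                (Nilmanifold.circle.ofLE (by norm_num : 1 ≤ 2))).prod
                  ((heisenbergWith dH h).prod (heisenbergWith dH h)))) i).G ⧸
          (Sum.elim (fun _ => Nilmanifold.circle.ofLE (by norm_num : 1 ≤ 2))
            (Sum.elim
              (fun _ => (Nilmanifold.circle.ofLE (by norm_num : 1 ≤ 2)).prod
                (Nilmanifold.circle.ofLE (by norm_num : 1 ≤ 2)))
              (fun _ => ((Nilmanifold.circle.ofLE (by norm_num : 1 ≤ 2)).prod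
                (Nilmanifold.circle.ofLE (by norm_num : 1 ≤ 2))).prod
                  ((heisenbergWith dH h).prod (heisenbergWith dH h)))) i).Γ)
        (M : Unit ⊕ (Fin d' ⊕ (Fin d' × Fin d')) → ℝ), (∀ i, 0 ≤ M i) → (∀ i y, ‖Φ i y‖ ≤ 1) →
        (∀ i y z, ‖Φ i y - Φ i z‖ ≤ M i *
          (Sum.elim (fun _ => Nilmanifold.circle.ofLE (by norm_num : 1 ≤ 2))
            (Sum.elim
              (fun _ => (Nilmanifold.circle.ofLE (by norm_num : 1 ≤ 2)).prod
                (Nilmanifold.circle.ofLE (by norm_num : 1 ≤ 2)))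
              (fun _ => ((Nilmanifold.circle.ofLE (by norm_num : 1 ≤ 2)).prod
                (Nilmanifold.circle.ofLE (by norm_num : 1 ≤ 2))).prod
                  ((heisenbergWith dH h).prod (heisenbergWith dH h)))) i).dist y z) →
        ∃ (Ψ : Z.G ⧸ Z.Γ → ℂ) (gZ : Z.G) (pZ : Z.G ⧸ Z.Γ),
          (∀ y, ‖Ψ y‖ ≤ 1) ∧ (∀ y z, ‖Ψ y - Ψ z‖ ≤ (∑ i, M i) * Z.dist y z) ∧
          ∀ n : ℤ, Ψ (gZ ^ n • pZ) = ∏ i, Φ i (g i ^ n • p i) :=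
    fun d' => exists_uniform_tensor (heisenbergWith dH h) _ (inHeisClass_factorFamily _ d')
  choose Z hZcls hZuniv using hZ
  -- Step 0': the constants of the stub
  obtain ⟨D₁, hD₁⟩ : ∃ D₁ : ℕ, D₁ = D + 1 := ⟨_, rfl⟩
  have hD₁1 : (1 : ℝ) ≤ D₁ := by rw [hD₁]; push_cast; linarith [(Nat.cast_nonneg D : (0 : ℝ) ≤ D)]
  have hD₁0 : (0 : ℝ) < D₁ := by linarith
  obtain ⟨R₆, hR₆⟩ : ∃ R₆ : ℝ,
      R₆ = K * R / (12800 * (D₁ : ℝ) * 2 ^ (D₁ * (D₁ + 2)) * (D₁ : ℝ) ^ 2) := ⟨_, rfl⟩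
  have hR₆0 : 0 < R₆ := by rw [hR₆]; positivity
  obtain ⟨Λ, hΛ⟩ : ∃ Λ : ℝ, Λ = 6400 * (D₁ : ℝ) / (K * R₆) := ⟨_, rfl⟩
  have hΛ0 : 0 ≤ Λ := by rw [hΛ]; positivity
  obtain ⟨Mmax, hMmax⟩ : ∃ Mmax : ℝ, Mmax = 2 * Real.pi + D₁ * ((Λ + 2 * Real.pi + 8) + 2 * Real.pi) +
      D₁ * D₁ * (2 * (Λ + 2 * Real.pi + 8) + 2 * ((4 * Real.pi + Λ + 8) * L)) := ⟨_, rfl⟩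
  obtain ⟨c, hc⟩ : ∃ c : ℝ, c = K / 128 * (R₆ / 2) ^ D₁ := ⟨_, rfl⟩
  have hc0 : 0 < c := by rw [hc]; positivity
  refine ⟨D + 1, fun i => Z i, Mmax, c, fun i => hZcls i, hc0, ?_⟩
  intro N _ hN h2 f hf hηf
  -- Step 1: the local quadratic correlation datum
  obtain ⟨k, S', ch, μ, ρ₄, ρ₅, x₀, t, ζ, hKk, hk1, hS'D, h1S', -, hRρ₅, hρ₅0, hρ₅4, hρ₄8, hreg₅,
    hadd, hx₀, hbig⟩ := hdata N hN h2 f hf hηf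
  have hk0 : 0 < k := hK0.trans_le hKk
  -- Steps 2–4: localisation, bracket factorisation, realisation on `Z #S'`
  obtain ⟨ρ₆, r₂, g, p₀, t₁, F, hρ₆lo, hρ₆0, hρ₆1, hr₂, hF, hcF⟩ :=
    exists_correlation_of_datum dH h hL0.le hcomp hN h2 f hf S' ch μ x₀ t ζ hk0 hk1 h1S' hρ₅0 hρ₅4
      hρ₄8 hreg₅ hadd hx₀ hbig (Z #S') (hZuniv #S')
  -- Step 5: the uniform bounds
  have hS'ne : S'.Nonempty := ⟨1, h1S'⟩
  have hd1 : (1 : ℝ) ≤ #S' := by exact_mod_cast Nat.one_le_iff_ne_zero.mpr (card_pos.mpr hS'ne).ne'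
  have hdD₁ : #S' ≤ D₁ := by rw [hD₁]; omega
  have hdD₁r : (#S' : ℝ) ≤ D₁ := by exact_mod_cast hdD₁
  have hρ₆R : R₆ ≤ ρ₆ := by
    rw [hR₆]
    refine le_trans ?_ hρ₆lo
    gcongr
    · norm_num
  have hΛ' : 6400 * (#S' : ℝ) / (k * ρ₆) ≤ Λ := by
    rw [hΛ]; gcongr
  have hq : 2 / (1 / 2 - r₂) ≤ 8 := by
    rw [div_le_iff₀ (by linarith)]; linarith
  have hq0 : 0 ≤ 2 / (1 / 2 - r₂) := by
    have : 0 < 1 / 2 - r₂ := by linarith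
    positivity
  have hLκ0 : 0 ≤ 6400 * (#S' : ℝ) / (k * ρ₆) := by positivity
  refine ⟨⟨#S', by omega⟩, g, p₀, t₁, F, isBoundedLipschitz_mono hF ?_, le_trans ?_ hcF⟩
  · -- the Lipschitz constant is at most `Mmax`
    rw [hMmax]
    gcongr
  · -- the correlation is at least `c`
    have hhalf1 : ρ₆ / 2 ≤ 1 := by linarith
    rw [hc]
    calc K / 128 * (R₆ / 2) ^ D₁ ≤ k / 128 * (ρ₆ / 2) ^ D₁ := by gcongr
      _ ≤ k / 128 * (ρ₆ / 2) ^ #S' := by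
          gcongr k / 128 * ?_
          exact pow_le_pow_of_le_one (by positivity) hhalf1 hdD₁

end Summit.Parity.GeneralizedHardyLittlewood.GreenTaoLevelTwoGITwoCyclicInverse
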